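import Summits.HodgeConjecture.CorCM.D2Bridge.NotHJAlbStarBijectiveOfLemma24Proj
import Summits.HodgeConjecture.CorCM.HypLiu418.A3Liu418PinBettiPinningAtPin
import Summits.HodgeConjecture.CorCM.HypLiu418.A3Liu418BettiThetaModelOffPlace
import Summits.HodgeConjecture.HodgeConjecture.Theorems.HCCMUnconditionalHLiu418OfFacts
import HarnessLib

/-!
# a3-liu418: GAP 1 at the pin, the off-place Betti theta model and the closing head `HLiu418` FROM THE PROJECTIVE ∕ (R-ℂ) FORM (Lp)
# OF [Liu2021, Lem. 2.4 (1)] — the cone side of the III-0 «(G)-road» (lead A-p18)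

Cell `hodgecm-mathlib`, fan A, crux `hLiu418` (stmt-HodgeConjecture-24832), row III-0.  THEOREMS ONLY; no `def`, no `sorry`, no named fact.
Twins of ✔ `pinBettiPinning_of_lemma24` (A-p18 p603007), ✔ `stubBettiThetaModelOffPlace_of_h413_of_unique_of_lemma24` (A-p02 p607116) and
✔ `HypLiu418.HLiu418_of_facts` (A-p18 p608878) in which the named fact `hL : Liu2021.albanese_bettiOne_pullback_bijective` ([Liu2021, Lem. 2.4 (1)]
for ALL proper smooth `X`) is replaced by the hypothesis **`hLp`** = Lemma 2.4 (1) for PROJECTIVE smooth `X / k ⊆ ℂ` whose complex pieces are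
smooth projective with `b₁ ≤ 2·dim J` ((R-ℂ)) — the exact shape the III-0 road proves (`Liu2021/Lemma24OfJacobianDimension.lean`, A-p17, over the
α-compatible finite-Galois Albanese fan ★ p612162/p612540/p611662/p613207 and A-p14's (R-bc) ★ p612173): the cone instantiates Lemma 2.4 only at
`X := X_K` (projective) with pieces the compact Picard modular surfaces (ball quotients, (R-ℂ) by Arapura Cor. 15.4.6 — ✔ C1
`LevelQReps.bijective_albStarQ_componentAlbanesePinTotal_of_lemma24Proj`, p613901).  Proof bodies = the originals character for character with the
one lemma swapped.  Final head: **`HypLiu418.HLiu418_of_facts_of_lemma24Proj (hLp) (hFal) (h415) (hε) (h21) (h413) (hD3) : HCCMUnconditional.HLiu418`**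
⇒ once (Lp) is a theorem, hLiu418 ⇐ {VI-1, III-9′, III-11} + items (row III-0 CLOSED for the cone).  HC_CM is proved only modulo the 7 printed
citations until rung 0 closes; this file discharges nothing by itself (`hLp` is a hypothesis).

## References
* [Liu2021] Y. Liu, arXiv:2102.11518 = Camb. J. Math. 9 (2021): Lem. 2.4 (1) (FJcycle.tex l. 1210–1228); §4.2 l. 2053–2081; Prop. 4.13; Thm. 4.18.
* [Arapura2012] Cor. 15.4.6; [Deligne1971TravauxShimura] 5.5; [Faltings1983Endlichkeit] §5; [MurtyRamakrishnan1992] Prop. 6; [BushnellHenniart2006] §41.2 (2).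
-/

set_option autoImplicit false

noncomputable section

/-! ## §1 GAP 1 at the pin from (Lp) (twin of `pinBettiPinning_of_lemma24`) -/

namespace Summit.HodgeConjecture.CorCM.Lines.A3Liu418

open CategoryTheory CategoryTheory.Limits AlgebraicGeometry MonoidalCategory CartesianMonoidalCategory
open Literature.AlgebraicGeometry.Motives
open AbelianVariety (bcFunctor)


open scoped TensorProduct Matrix
open NumberField NumberField.InfinitePlace
open HodgeCM.Model HodgeCM.Model.LiuIndex HodgeCM.Model.TowerCarrier
open Summit.HodgeConjecture.CorCM.Model
open Literature.AlgebraicGeometry.Motives (CMType)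
open Literature.AlgebraicGeometry.HodgeTheory Literature.NumberTheory.Automorphic.PicardCM
open Literature.AlgebraicGeometry.ShimuraVarieties.UnitaryCanonicalModel
open Literature.NumberTheory.ComplexMultiplication
open Literature.NumberTheory.Automorphic
open Literature.NumberTheory.Automorphic.Liu2021 Literature.NumberTheory.Automorphic.Liu2021.AppendixC
open Literature.NumberTheory.Automorphic.Liu2021.AppendixC.RestOne
open Summit.HodgeConjecture.CorCM.Transposition.OmegaTransport (realUnit)
open Literature.RepresentationTheory Literature.RepresentationTheory.Liu2021
open Summit.HodgeConjecture.CorCM.Transposition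
open Summit.HodgeConjecture.CorCM.D2Bridge
open Summit.HodgeConjecture.CorCM.D2Bridge.MuKeyIdentLemD3End
open Summit.HodgeConjecture.CorCM.D2Bridge.MuKeyIdentLemD3DelRecConjOmegaEndT

set_option synthInstance.maxHeartbeats 400000 in
set_option maxHeartbeats 4000000 in
/-- **GAP 1 at the pin from (Lp)** — `pinBettiPinning_of_lemma24` with `hL` replaced by the projective∕(R-ℂ) shape `hLp` (the pin's `X_K` is projective and its
pieces are compact ball quotients: C1 `LevelQReps.bijective_albStarQ_componentAlbanesePinTotal_of_lemma24Proj`).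
[cite: Liu2021, §4.2 l. 2074–2081; Lem. 2.4 (1) l. 1210–1228; Thm. 4.18 proof l. 2247–2257] -/
theorem pinBettiPinning_of_lemma24Proj
    (hLp : ∀ {k : Type} [Field k] [CharZero k] [Algebra k ℂ] {d : ℕ} (X : SchemeOver k) [SmoothOfRelativeDimension d X.hom],
      IsProjectiveOver X → ∀ (a : Albanese X) (Ξ : Type) (Y : Ξ → SchemeOver ℂ) [∀ q, GeometricallyIrreducible (Y q).hom]
        (inj : ∀ q, Y q ⟶ (bcFunctor k ℂ).obj X) (_ : IsColimit (Cofan.mk ((bcFunctor k ℂ).obj X) inj))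
        {d' : ℕ} (_ : ∀ q, IsSmoothProjective d' (Y q))
        (_ : ∀ (q : Ξ) (𝒥 : Jacobian (Y q)), Module.finrank ℚ (bettiCohomology (Y q) 1) ≤ 2 * 𝒥.J.dim)
        (x : ∀ q, AlgPoints (Y q) ℂ) (ℓ : ∀ q, Y q ⊗ Y q ⟶ (bcFunctor k ℂ).obj a.nabla.N)
        (_ : ∀ q, ℓ q ≫ (bcFunctor k ℂ).map a.nabla.incl = (inj q ⊗ₘ inj q) ≫ Functor.LaxMonoidal.μ (bcFunctor k ℂ) X X)
        (αx : (bcFunctor k ℂ).obj X ⟶ (a.Alb.baseChange ℂ).X)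
        (_ : ∀ q, inj q ≫ αx = lift (𝟙 (Y q)) (toSpecOver (Y q) ≫ x q) ≫ ℓ q ≫ (bcFunctor k ℂ).map a.α),
        Function.Bijective (BettiUniverse.pull αx 1)) :
    ∀ (hDel : Literature.AlgebraicGeometry.ShimuraVarieties.UnitaryCanonicalModel.canonicalModel_exists_printed)
      (F : HodgeCM.CMField) [IsGalois ℚ F] (h6 : 6 ≤ Module.finrank ℚ F) {ι₁ : F →+* ℂ} (V : HodgeCM.HermSpace3 F ι₁) (a : RealScalar F)
      (Φ : CMType F),
      ∃ τ' : (F : Type) →+* ℂ, Nonempty ((sec42DataOf (Summit.HodgeConjecture.CorCM.DelRec.exists_recordSystem_of_printed hDel) isoOf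
        ⟨HodgeCM.CMField.K F⟩ ι₁ ⟨HodgeCM.HermSpace3.Hm V, HodgeCM.HermSpace3.isHermitian V, HodgeCM.HermSpace3.signature_ι₁ V,
          HodgeCM.HermSpace3.posDef_of_ne V⟩ Φ).BettiPinning
        (heckeTranslatesFamilyOf heckeTranslate_definedOver_holds (Summit.HodgeConjecture.CorCM.DelRec.exists_recordSystem_of_printed hDel)
          isoOf ⟨HodgeCM.CMField.K F⟩ ι₁ ⟨HodgeCM.HermSpace3.Hm V, HodgeCM.HermSpace3.isHermitian V, HodgeCM.HermSpace3.signature_ι₁ V,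
            HodgeCM.HermSpace3.posDef_of_ne V⟩ Φ h6)
        τ'
        ((liuDictionaryPin exists_isReal_hodgeModel_holds hodgePQ_independent_of_hodgeModel_holds BallQuotient.ballQuotientUniformised_holds
            (cmAbelianVarietyRealised_of_eigenbasis exists_isReal_hodgeModel_holds hodgePQ_independent_of_hodgeModel_holds
              cmAbelianVarietyEigenbasisRealised_holds)
            Literature.NumberTheory.Transcendental.arapura2012_cor_15_4_6_holds V (I V (repAt a) (muLiu ι₁ GramClass.rep))
            (line V (repAt a) (muLiu ι₁ GramClass.rep))).H)
        (Representation.ofModule' _)) := by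
  intro hDel F _ h6 ι₁ V a Φ
  -- the geometric-pin instance `algebraMap F ℂ := ῑ₁ = conj ∘ ι₁`, under which `algebraMap ∘ c = ι₁`
  letI : Algebra (F : Type) ℂ := ((starRingEnd ℂ).comp ι₁).toAlgebra
  have hinst : ∀ x : F, algebraMap (F : Type) ℂ x = ((starRingEnd ℂ).comp ι₁) x := fun _ => rfl
  have hι : (algebraMap (F : Type) ℂ).comp (cmConjRingHom F) = ι₁ := by
    ext x
    rw [RingHom.coe_comp, Function.comp_apply, hinst, embedding_cmConjRingHom, RingHom.coe_comp, Function.comp_apply,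
      starRingEnd_self_apply]
  have h4 : 4 ≤ Module.finrank ℚ F := le_trans (by norm_num) h6
  exact ⟨algebraMap (F : Type) ℂ,
    nonempty_bettiPinning_of_componentAlbanese exists_isReal_hodgeModel_holds hodgePQ_independent_of_hodgeModel_holds
      (ballQuotientUniformisedDatum_of BallQuotient.ballQuotientUniformised_holds)
      (cmAbelianVarietyRealised_of_eigenbasis exists_isReal_hodgeModel_holds hodgePQ_independent_of_hodgeModel_holds
        cmAbelianVarietyEigenbasisRealised_holds)
      Literature.NumberTheory.Transcendental.arapura2012_cor_15_4_6_holds V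
      (Summit.HodgeConjecture.CorCM.DelRec.exists_recordSystem_of_printed hDel) Φ _ _ h4
      (componentAlbanesePinTotal exists_isReal_hodgeModel_holds hodgePQ_independent_of_hodgeModel_holds
        (ballQuotientUniformisedDatum_of BallQuotient.ballQuotientUniformised_holds)
        (cmAbelianVarietyRealised_of_eigenbasis exists_isReal_hodgeModel_holds hodgePQ_independent_of_hodgeModel_holds
          cmAbelianVarietyEigenbasisRealised_holds)
        Literature.NumberTheory.Transcendental.arapura2012_cor_15_4_6_holds heckeTranslate_definedOver_holds V
        (Summit.HodgeConjecture.CorCM.DelRec.exists_recordSystem_of_printed hDel) h4 hι Φ isoOf)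
      (componentAlbanesePinTotal_levelLaw exists_isReal_hodgeModel_holds hodgePQ_independent_of_hodgeModel_holds
        (ballQuotientUniformisedDatum_of BallQuotient.ballQuotientUniformised_holds)
        (cmAbelianVarietyRealised_of_eigenbasis exists_isReal_hodgeModel_holds hodgePQ_independent_of_hodgeModel_holds
          cmAbelianVarietyEigenbasisRealised_holds)
        Literature.NumberTheory.Transcendental.arapura2012_cor_15_4_6_holds heckeTranslate_definedOver_holds V
        (Summit.HodgeConjecture.CorCM.DelRec.exists_recordSystem_of_printed hDel) h4 hι Φ isoOf)
      (LevelQReps.bijective_albStarQ_componentAlbanesePinTotal_of_lemma24Proj hLp V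
        (ballQuotientUniformisedDatum_of BallQuotient.ballQuotientUniformised_holds)
        (cmAbelianVarietyRealised_of_eigenbasis exists_isReal_hodgeModel_holds hodgePQ_independent_of_hodgeModel_holds
          cmAbelianVarietyEigenbasisRealised_holds)
        h4 (Summit.HodgeConjecture.CorCM.DelRec.exists_recordSystem_of_printed hDel) exists_isReal_hodgeModel_holds hι
        hodgePQ_independent_of_hodgeModel_holds Literature.NumberTheory.Transcendental.arapura2012_cor_15_4_6_holds
        heckeTranslate_definedOver_holds Φ isoOf)⟩

end Summit.HodgeConjecture.CorCM.Lines.A3Liu418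

/-! ## §2 The off-place Betti theta model from (Lp) (twin of A-p02's `stubBettiThetaModelOffPlace_of_h413_of_unique_of_lemma24`) -/

namespace Summit.HodgeConjecture.CorCM.Lines.A3Liu418

open CategoryTheory CategoryTheory.Limits AlgebraicGeometry MonoidalCategory CartesianMonoidalCategory
open Literature.AlgebraicGeometry.Motives
open AbelianVariety (bcFunctor)


open scoped TensorProduct Matrix
open CategoryTheory NumberField NumberField.InfinitePlace
open HodgeCM.Model HodgeCM.Model.LiuIndex HodgeCM.Model.TowerCarrier
open Summit.HodgeConjecture.CorCM.Model
open Summit.HodgeConjecture.CorCM.Model.RecordSystemConj (exists_albIso_albTr_comm)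
open Literature.AlgebraicGeometry.Motives (CMType)
open Literature.AlgebraicGeometry.HodgeTheory Literature.NumberTheory.Automorphic.PicardCM
open Literature.AlgebraicGeometry.ShimuraVarieties.UnitaryCanonicalModel
open Literature.NumberTheory.ComplexMultiplication
open Literature.NumberTheory.Automorphic
open Literature.NumberTheory.Automorphic.IdeleClassGroup (toHeckeCharacter isUnitary_toHeckeCharacter galConj)
open Literature.NumberTheory.Automorphic.Liu2021 Literature.NumberTheory.Automorphic.Liu2021.AppendixC
open Literature.NumberTheory.Automorphic.Liu2021.AppendixC.RestOne
open Literature.NumberTheory.Automorphic.Liu2021.Def411WeilCarriers (lineOf locF Rep)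
open Summit.HodgeConjecture.CorCM.Transposition.OmegaTransport (realUnit)
open HodgeCM.Model.ArchSideTerm (e₁)
open Literature.NumberTheory.GelbartRogawski1991 Literature.NumberTheory.GelbartRogawski1991.UnitaryDualPair
open Literature.RepresentationTheory Literature.RepresentationTheory.Liu2021
open Summit.HodgeConjecture.CorCM.Transposition
open Summit.HodgeConjecture.CorCM.D2Bridge.AdapterMuConj (muConj)
open scoped DirectSum

/-- **The off-place Betti theta model from (Lp)** — A-p02's `stubBettiThetaModelOffPlace_of_h413_of_unique_of_lemma24` (flip the face to
`(τ̄, V.alongConj, a, Φ̄)`, which is at place with `τ̄ ∈ Φ̄`; [Prop 4.13] there (`h413`) on the pin pinned by GAP 1; transport the pinning along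
the Albanese isomorphisms of the canonical-model uniqueness (`hU`, row I-4 — now a theorem, fed by the caller) and D2 `BettiPinningTransport`;
the Weil family has the same Gram class) with GAP 1 taken from `pinBettiPinning_of_lemma24Proj hLp` instead of the named fact.  Body character
for character A-p02's. [cite: Liu2021, Prop. 4.13; §4.2; App. C §C.1] [cite: Deligne1971TravauxShimura, 5.5] -/
theorem stubBettiThetaModelOffPlace_of_h413_of_unique_of_lemma24Proj
    (hLp : ∀ {k : Type} [Field k] [CharZero k] [Algebra k ℂ] {d : ℕ} (X : SchemeOver k) [SmoothOfRelativeDimension d X.hom],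
      IsProjectiveOver X → ∀ (a : Albanese X) (Ξ : Type) (Y : Ξ → SchemeOver ℂ) [∀ q, GeometricallyIrreducible (Y q).hom]
        (inj : ∀ q, Y q ⟶ (bcFunctor k ℂ).obj X) (_ : IsColimit (Cofan.mk ((bcFunctor k ℂ).obj X) inj))
        {d' : ℕ} (_ : ∀ q, IsSmoothProjective d' (Y q))
        (_ : ∀ (q : Ξ) (𝒥 : Jacobian (Y q)), Module.finrank ℚ (bettiCohomology (Y q) 1) ≤ 2 * 𝒥.J.dim)
        (x : ∀ q, AlgPoints (Y q) ℂ) (ℓ : ∀ q, Y q ⊗ Y q ⟶ (bcFunctor k ℂ).obj a.nabla.N)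
        (_ : ∀ q, ℓ q ≫ (bcFunctor k ℂ).map a.nabla.incl = (inj q ⊗ₘ inj q) ≫ Functor.LaxMonoidal.μ (bcFunctor k ℂ) X X)
        (αx : (bcFunctor k ℂ).obj X ⟶ (a.Alb.baseChange ℂ).X)
        (_ : ∀ q, inj q ≫ αx = lift (𝟙 (Y q)) (toSpecOver (Y q) ≫ x q) ≫ ℓ q ≫ (bcFunctor k ℂ).map a.α),
        Function.Bijective (BettiUniverse.pull αx 1))
    (h413 : Summit.HodgeConjecture.HodgeConjecture.Theses.HCCMUnconditional.H413)
    (hU : canonicalModel_unique_printed) :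
    ∀ (hDel : Literature.AlgebraicGeometry.ShimuraVarieties.UnitaryCanonicalModel.canonicalModel_exists_printed)
      (F : HodgeCM.CMField) [IsGalois ℚ F] (h6 : 6 ≤ Module.finrank ℚ F) {ι₁ : F →+* ℂ} (V : HodgeCM.HermSpace3 F ι₁)
      (hoff : (NumberField.InfinitePlace.mk ι₁).embedding ≠ ι₁) (a : RealScalar F) (Φ : CMType F) (hΦ : ι₁ ∈ Φ.1),
      ∃ (τ' : (F : Type) →+* ℂ) (H : Type) (_ : AddCommGroup H) (_ : Module ℂ H) (rhoB : Representation ℂ (sec42DataOf (Summit.HodgeConjecture.CorCM.DelRec.exists_recordSystem_of_printed hDel) isoOf ⟨HodgeCM.CMField.K F⟩ ι₁ ⟨HodgeCM.HermSpace3.Hm V, HodgeCM.HermSpace3.isHermitian V, HodgeCM.HermSpace3.signature_ι₁ V, HodgeCM.HermSpace3.posDef_of_ne V⟩ Φ).G H),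
        Nonempty ((sec42DataOf (Summit.HodgeConjecture.CorCM.DelRec.exists_recordSystem_of_printed hDel) isoOf ⟨HodgeCM.CMField.K F⟩ ι₁ ⟨HodgeCM.HermSpace3.Hm V, HodgeCM.HermSpace3.isHermitian V, HodgeCM.HermSpace3.signature_ι₁ V, HodgeCM.HermSpace3.posDef_of_ne V⟩ Φ).BettiPinning (heckeTranslatesFamilyOf heckeTranslate_definedOver_holds (Summit.HodgeConjecture.CorCM.DelRec.exists_recordSystem_of_printed hDel) isoOf ⟨HodgeCM.CMField.K F⟩ ι₁ ⟨HodgeCM.HermSpace3.Hm V, HodgeCM.HermSpace3.isHermitian V, HodgeCM.HermSpace3.signature_ι₁ V, HodgeCM.HermSpace3.posDef_of_ne V⟩ Φ h6) τ' H rhoB) ∧ BettiThetaDecomposition (Summit.HodgeConjecture.CorCM.D2Bridge.AdapterMuConj.muConj (uniformOmegaRep (Summit.HodgeConjecture.CorCM.DelRec.exists_recordSystem_of_printed hDel) ⟨HodgeCM.CMField.K F⟩ ι₁ ⟨HodgeCM.HermSpace3.Hm V, HodgeCM.HermSpace3.isHermitian V, HodgeCM.HermSpace3.signature_ι₁ V,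 HodgeCM.HermSpace3.posDef_of_ne V⟩ Φ e₁ (frameD V) (frameD_real V) (frameD_ne V) (ιVE V) (2 * imagUnit (HodgeCM.CMField.K F))⁻¹ (fun _ _ => (Rep.update ↥(maximalRealSubfield (HodgeCM.CMField.K F)) (imagUnitSq (HodgeCM.CMField.K F)) (Rep.ofLineOf ↥(maximalRealSubfield (HodgeCM.CMField.K F)) (imagUnitSq (HodgeCM.CMField.K F))) (locF ↥(maximalRealSubfield (HodgeCM.CMField.K F)) (imagUnitSq (HodgeCM.CMField.K F)) (realUnit ⟨HodgeCM.CMField.K F⟩ a.1 a.2.1 a.2.2)) (realUnit ⟨HodgeCM.CMField.K F⟩ a.1 a.2.1 a.2.2) rfl)))) H rhoB := by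
  intro hDel F _ h6 ι₁ V hoff a Φ hΦ
  -- the flipped face `(τ̄, V.alongConj, a, Φ̄)` is at place and carries `τ̄ ∈ Φ̄`
  have hemb := Summit.HodgeConjecture.CorCM.OffPlaceFace.embedding_mk_starRingEnd_comp_of_ne hoff
  have hΦ' : (starRingEnd ℂ).comp ι₁ ∈ (CMTypeOps.bar Φ).1 := Summit.HodgeConjecture.CorCM.OffPlaceFace.starRingEnd_comp_mem_bar hΦ
  obtain ⟨τ', H, _, _, rhoB, ⟨B₀⟩, hΘ₀⟩ :=
    bettiThetaModelAtPlace_of_hyp413_of_pinning h413 (pinBettiPinning_of_lemma24Proj hLp) hDel F h6 V.alongConj hemb a (CMTypeOps.bar Φ) hΦ'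
  refine ⟨τ', H, inferInstance, inferInstance, rhoB, ?_, ?_⟩
  · -- (ii) the Betti pinning: dite ↦ explicit at the flipped face, transport along the Albanese isomorphisms (D1 + D2), explicit ↦ dite back
    have h4 : 4 ≤ Module.finrank ℚ F := le_trans (by norm_num) h6
    obtain ⟨B₀'⟩ := bettiPinning_transport_eq
      (sec42DataOf_eq_of_four_le (Summit.HodgeConjecture.CorCM.DelRec.exists_recordSystem_of_printed hDel)
        (⟨HodgeCM.HermSpace3.Hm V.alongConj, HodgeCM.HermSpace3.isHermitian V.alongConj, HodgeCM.HermSpace3.signature_ι₁ V.alongConj,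
          HodgeCM.HermSpace3.posDef_of_ne V.alongConj⟩ : HermSpace3 ⟨HodgeCM.CMField.K F⟩ ((starRingEnd ℂ).comp ι₁)) (CMTypeOps.bar Φ) isoOf h4).symm
      (sec42DataOf_heckeTranslates_heq heckeTranslate_definedOver_holds (Summit.HodgeConjecture.CorCM.DelRec.exists_recordSystem_of_printed hDel)
        (⟨HodgeCM.HermSpace3.Hm V.alongConj, HodgeCM.HermSpace3.isHermitian V.alongConj, HodgeCM.HermSpace3.signature_ι₁ V.alongConj,
          HodgeCM.HermSpace3.posDef_of_ne V.alongConj⟩ : HermSpace3 ⟨HodgeCM.CMField.K F⟩ ((starRingEnd ℂ).comp ι₁)) (CMTypeOps.bar Φ) isoOf h4).symm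
      ⟨B₀⟩
    obtain ⟨α, hα⟩ := exists_albIso_albTr_comm heckeTranslate_definedOver_holds hU
      (Summit.HodgeConjecture.CorCM.DelRec.exists_recordSystem_of_printed hDel)
      (⟨HodgeCM.HermSpace3.Hm V, HodgeCM.HermSpace3.isHermitian V, HodgeCM.HermSpace3.signature_ι₁ V, HodgeCM.HermSpace3.posDef_of_ne V⟩ :
        HermSpace3 ⟨HodgeCM.CMField.K F⟩ ι₁) Φ (CMTypeOps.bar Φ) h4
      (isoOf ⟨HodgeCM.CMField.K F⟩ ι₁ ⟨HodgeCM.HermSpace3.Hm V, HodgeCM.HermSpace3.isHermitian V, HodgeCM.HermSpace3.signature_ι₁ V,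
        HodgeCM.HermSpace3.posDef_of_ne V⟩ Φ)
      (isoOf ⟨HodgeCM.CMField.K F⟩ ((starRingEnd ℂ).comp ι₁) ⟨HodgeCM.HermSpace3.Hm V.alongConj, HodgeCM.HermSpace3.isHermitian V.alongConj,
        HodgeCM.HermSpace3.signature_ι₁ V.alongConj, HodgeCM.HermSpace3.posDef_of_ne V.alongConj⟩ (CMTypeOps.bar Φ))
    have B₁' := Sec42Data.BettiPinning.nonempty_transport
      (sec42DataOfFourLe_heckeTranslates heckeTranslate_definedOver_holds (Summit.HodgeConjecture.CorCM.DelRec.exists_recordSystem_of_printed hDel)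
        (⟨HodgeCM.HermSpace3.Hm V, HodgeCM.HermSpace3.isHermitian V, HodgeCM.HermSpace3.signature_ι₁ V, HodgeCM.HermSpace3.posDef_of_ne V⟩ :
          HermSpace3 ⟨HodgeCM.CMField.K F⟩ ι₁) Φ h4
        (isoOf ⟨HodgeCM.CMField.K F⟩ ι₁ ⟨HodgeCM.HermSpace3.Hm V, HodgeCM.HermSpace3.isHermitian V, HodgeCM.HermSpace3.signature_ι₁ V,
          HodgeCM.HermSpace3.posDef_of_ne V⟩ Φ))
      (sec42DataOfFourLe_heckeTranslates heckeTranslate_definedOver_holds (Summit.HodgeConjecture.CorCM.DelRec.exists_recordSystem_of_printed hDel)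
        (⟨HodgeCM.HermSpace3.Hm V.alongConj, HodgeCM.HermSpace3.isHermitian V.alongConj, HodgeCM.HermSpace3.signature_ι₁ V.alongConj,
          HodgeCM.HermSpace3.posDef_of_ne V.alongConj⟩ : HermSpace3 ⟨HodgeCM.CMField.K F⟩ ((starRingEnd ℂ).comp ι₁)) (CMTypeOps.bar Φ) h4
        (isoOf ⟨HodgeCM.CMField.K F⟩ ((starRingEnd ℂ).comp ι₁) ⟨HodgeCM.HermSpace3.Hm V.alongConj, HodgeCM.HermSpace3.isHermitian V.alongConj,
          HodgeCM.HermSpace3.signature_ι₁ V.alongConj, HodgeCM.HermSpace3.posDef_of_ne V.alongConj⟩ (CMTypeOps.bar Φ)))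
      (fun g => g) (fun K => K) (fun K => ⟨K, rfl⟩) (fun hK => hK) α hα (rhoB := rhoB) (rhoB' := rhoB) (fun _ => rfl) B₀'
    exact bettiPinning_transport_eq
      (sec42DataOf_eq_of_four_le (Summit.HodgeConjecture.CorCM.DelRec.exists_recordSystem_of_printed hDel)
        (⟨HodgeCM.HermSpace3.Hm V, HodgeCM.HermSpace3.isHermitian V, HodgeCM.HermSpace3.signature_ι₁ V, HodgeCM.HermSpace3.posDef_of_ne V⟩ :
          HermSpace3 ⟨HodgeCM.CMField.K F⟩ ι₁) Φ isoOf h4)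
      (sec42DataOf_heckeTranslates_heq heckeTranslate_definedOver_holds (Summit.HodgeConjecture.CorCM.DelRec.exists_recordSystem_of_printed hDel)
        (⟨HodgeCM.HermSpace3.Hm V, HodgeCM.HermSpace3.isHermitian V, HodgeCM.HermSpace3.signature_ι₁ V, HodgeCM.HermSpace3.posDef_of_ne V⟩ :
          HermSpace3 ⟨HodgeCM.CMField.K F⟩ ι₁) Φ isoOf h4) B₁'
  · -- (i) the Weil side: same carriers, re-indexed (FILE C)
    exact bettiThetaDecomposition_of_sameGram (Summit.HodgeConjecture.CorCM.DelRec.exists_recordSystem_of_printed hDel) F V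
      (HodgeCM.HermSpace3.signature_ι₁ V.alongConj) (HodgeCM.HermSpace3.posDef_of_ne V.alongConj) a Φ (CMTypeOps.bar Φ) H rhoB hΘ₀

end Summit.HodgeConjecture.CorCM.Lines.A3Liu418

/-! ## §3 The closing head `HLiu418` from (Lp) (twin of `HypLiu418.HLiu418_of_facts`) -/

namespace Summit.HodgeConjecture.CorCM.HypLiu418

open scoped TensorProduct Matrix
open NumberField NumberField.InfinitePlace
open HodgeCM.Model HodgeCM.Model.LiuIndex HodgeCM.Model.TowerCarrier
open Summit.HodgeConjecture.CorCM.Model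
open Literature.AlgebraicGeometry.Motives (CMType AbelianVariety)
open Literature.AlgebraicGeometry.HodgeTheory Literature.NumberTheory.Automorphic.PicardCM
open Literature.AlgebraicGeometry.ShimuraVarieties.UnitaryCanonicalModel
open Literature.NumberTheory.ComplexMultiplication
open Literature.NumberTheory.Automorphic
open Literature.NumberTheory.Automorphic.Liu2021 Literature.NumberTheory.Automorphic.Liu2021.AppendixC
open Literature.NumberTheory.Automorphic.Liu2021.AppendixC.RestOne
open Literature.RepresentationTheory Literature.RepresentationTheory.Liu2021
open Summit.HodgeConjecture.CorCM.Transposition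
open Summit.HodgeConjecture.CorCM.D2Bridge.MuKeyIdentLemD3DelRecConjOmegaEndT.PrintedCitationHypotheses (HypLiu418 Hyp411 Hyp413 HypD3 HypD1pp)
open Summit.HodgeConjecture.CorCM.Lines.A3Liu418
open Summit.HodgeConjecture.HodgeConjecture.Theses (HCCMUnconditional.HLiu418 HCCMUnconditional.H21 HCCMUnconditional.H413 HCCMUnconditional.HD3
  HCCMUnconditional.HDel)

open CategoryTheory CategoryTheory.Limits AlgebraicGeometry MonoidalCategory CartesianMonoidalCategory
open Literature.AlgebraicGeometry.Motives
open AbelianVariety (bcFunctor)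

set_option synthInstance.maxHeartbeats 400000 in
set_option maxHeartbeats 8000000 in
/-- **P from `H413` and (Lp)** — `HypLiu418.bettiThetaModel_of_facts` with GAP 1 and the off-place model taken from (Lp) (`pinBettiPinning_of_lemma24Proj`,
`stubBettiThetaModelOffPlace_of_h413_of_unique_of_lemma24Proj`; row I-4 by `canonicalModel_unique_printed_holds`). [cite: Liu2021, Prop. 4.13; §4.2 l. 2074–2081; Lem. 2.4] -/
theorem bettiThetaModel_of_lemma24Proj
    (hLp : ∀ {k : Type} [Field k] [CharZero k] [Algebra k ℂ] {d : ℕ} (X : SchemeOver k) [SmoothOfRelativeDimension d X.hom],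
      IsProjectiveOver X → ∀ (a : Albanese X) (Ξ : Type) (Y : Ξ → SchemeOver ℂ) [∀ q, GeometricallyIrreducible (Y q).hom]
        (inj : ∀ q, Y q ⟶ (bcFunctor k ℂ).obj X) (_ : IsColimit (Cofan.mk ((bcFunctor k ℂ).obj X) inj))
        {d' : ℕ} (_ : ∀ q, IsSmoothProjective d' (Y q))
        (_ : ∀ (q : Ξ) (𝒥 : Jacobian (Y q)), Module.finrank ℚ (bettiCohomology (Y q) 1) ≤ 2 * 𝒥.J.dim)
        (x : ∀ q, AlgPoints (Y q) ℂ) (ℓ : ∀ q, Y q ⊗ Y q ⟶ (bcFunctor k ℂ).obj a.nabla.N)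
        (_ : ∀ q, ℓ q ≫ (bcFunctor k ℂ).map a.nabla.incl = (inj q ⊗ₘ inj q) ≫ Functor.LaxMonoidal.μ (bcFunctor k ℂ) X X)
        (αx : (bcFunctor k ℂ).obj X ⟶ (a.Alb.baseChange ℂ).X)
        (_ : ∀ q, inj q ≫ αx = lift (𝟙 (Y q)) (toSpecOver (Y q) ≫ x q) ≫ ℓ q ≫ (bcFunctor k ℂ).map a.α),
        Function.Bijective (BettiUniverse.pull αx 1))
    (h413 : Summit.HodgeConjecture.HodgeConjecture.Theses.HCCMUnconditional.H413) : StubBettiThetaModel := by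
  intro hDel F _ h6 ι₁ V a Φ hΦ
  by_cases hemb : (NumberField.InfinitePlace.mk ι₁).embedding = ι₁
  · exact bettiThetaModelAtPlace_of_hyp413_of_pinning h413 (pinBettiPinning_of_lemma24Proj hLp) hDel F h6 V hemb a Φ hΦ
  · exact stubBettiThetaModelOffPlace_of_h413_of_unique_of_lemma24Proj hLp h413 canonicalModel_unique_printed_holds hDel F h6 V hemb a Φ hΦ

set_option synthInstance.maxHeartbeats 400000 in
set_option maxHeartbeats 8000000 in
/-- **CLOSING HEAD of item stmt-HodgeConjecture-24832 from (Lp) instead of row III-0** — `HypLiu418.HLiu418_of_facts` with its binder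
`hL : albanese_bettiOne_pullback_bijective` REPLACED by the projective∕(R-ℂ) shape `hLp` that the III-0 road proves
(`Liu2021/Lemma24OfJacobianDimension.lean`): modulo (Lp), hLiu418 ⇐ {VI-1 `hFal`, III-9′ `h415`, III-11 `hε`} + the items `H21`, `H413`, `HD3`.
Composition character for character that of `HLiu418_of_facts`.  HC_CM is proved only modulo the 7 printed citations until rung 0 closes.
[cite: Liu2021, Thm. 4.18 (FJcycle.tex l. 2235–2290); Lem. 2.4 (1)] -/
theorem HLiu418_of_facts_of_lemma24Proj
    (hLp : ∀ {k : Type} [Field k] [CharZero k] [Algebra k ℂ] {d : ℕ} (X : SchemeOver k) [SmoothOfRelativeDimension d X.hom],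
      IsProjectiveOver X → ∀ (a : Albanese X) (Ξ : Type) (Y : Ξ → SchemeOver ℂ) [∀ q, GeometricallyIrreducible (Y q).hom]
        (inj : ∀ q, Y q ⟶ (bcFunctor k ℂ).obj X) (_ : IsColimit (Cofan.mk ((bcFunctor k ℂ).obj X) inj))
        {d' : ℕ} (_ : ∀ q, IsSmoothProjective d' (Y q))
        (_ : ∀ (q : Ξ) (𝒥 : Jacobian (Y q)), Module.finrank ℚ (bettiCohomology (Y q) 1) ≤ 2 * 𝒥.J.dim)
        (x : ∀ q, AlgPoints (Y q) ℂ) (ℓ : ∀ q, Y q ⊗ Y q ⟶ (bcFunctor k ℂ).obj a.nabla.N)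
        (_ : ∀ q, ℓ q ≫ (bcFunctor k ℂ).map a.nabla.incl = (inj q ⊗ₘ inj q) ≫ Functor.LaxMonoidal.μ (bcFunctor k ℂ) X X)
        (αx : (bcFunctor k ℂ).obj X ⟶ (a.Alb.baseChange ℂ).X)
        (_ : ∀ q, inj q ≫ αx = lift (𝟙 (Y q)) (toSpecOver (Y q) ≫ x q) ≫ ℓ q ≫ (bcFunctor k ℂ).map a.α),
        Function.Bijective (BettiUniverse.pull αx 1))
    (hFal : ∀ {K : Type} [Field K] (A B : AbelianVariety K) (ℓ : ℕ) [Fact ℓ.Prime], Literature.AlgebraicGeometry.Motives.faltings_tate_bijective A B ℓ)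
    (h415 : Thm415AtFace) (hε : EpsRigidAtFace)
    (h21 : Summit.HodgeConjecture.HodgeConjecture.Theses.HCCMUnconditional.H21) (h413 : Summit.HodgeConjecture.HodgeConjecture.Theses.HCCMUnconditional.H413)
    (hD3 : Summit.HodgeConjecture.HodgeConjecture.Theses.HCCMUnconditional.HD3) :
    Summit.HodgeConjecture.HodgeConjecture.Theses.HCCMUnconditional.HLiu418 := by
  intro hDel F _ h6 ι₁ V a Φ hΦ ν hν hw R' hR' Φ'
  have hP : StubBettiThetaModel := bettiThetaModel_of_lemma24Proj hLp h413
  have s2 : StubNonIso := nonIso_of_hD3 hD3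
  exact thm418AsPrinted_of_items _
    (mainGalois_of_facts (etaleBettiModel_of_facts hP) (faltingsIsotypic_of_faltings hFal) (galoisLabelSeparation_of_h21_of_thm415 h21 h415)
      (mainGaloisGlue_of_h21_of_epsRigid h21 hε) h415 Summit.HodgeConjecture.HodgeConjecture.Theorems.H411_proof s2 hDel F h6 V a Φ hΦ ν hν hw Φ' ⟨R', hR'⟩)
    (levelInvariants_holds hDel F h6 V a Φ hΦ ν hν hw Φ') (s2 hDel F h6 V a Φ hΦ ν hν hw Φ')

end Summit.HodgeConjecture.CorCM.HypLiu418

end
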